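import Literature.NumberTheory.Automorphic.RootData
import HarnessLib

/-!
# Roots of a linear algebraic group: proof of `roots_finite`

Companion to `RootData.lean` (theorems only; the sibling `RootDataProofs.lean` treats the
reducedness fact `isReduced_of_isRootDatumOf`). This file discharges the named fact
`Literature.NumberTheory.Automorphic.roots_finite` of `Literature.NumberTheory.Automorphic.RootData`:

* `Literature.Automorphic.roots_finite_holds : roots_finite` — the set `roots G T` of roots of a connected
  reductive `G ≤ GL n k` relative to a maximal torus `T`, over an algebraically closed field, is
  finite (Springer, *Linear Algebraic Groups*, 7.4.3 with 7.1.1 and 8.1.1–8.1.2);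
* `Literature.NumberTheory.Automorphic.roots_finite_of_infinite` — the same conclusion for arbitrary subgroups
  `T, G ≤ GL n k` over any infinite field (the hypotheses of the fact are not needed);
* `Literature.NumberTheory.Automorphic.IsRootHom.exists_weightVector` — the differential of a root homomorphism is a
  non-zero weight vector of weight `α` for `Ad T` on `𝔤𝔩ₙ` (Springer 8.1.1 (i), `Im du_α = 𝔤_α`).

## The argument (Springer 7.1.1, 7.4.3, 8.1.1–8.1.2, made elementary)

In Springer the roots `R(G, T)` are non-zero weights of `T` acting on the Lie algebra `𝔤 ⊆ 𝔤𝔩ₙ`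
through `Ad` (7.4.3, 8.1.2), and the set of weights of a torus in a finite-dimensional rational
representation is finite (7.1.1). With the vocabulary of `RootData` (roots are the characters
admitting a root homomorphism in the sense of 8.1.1 (i)) this becomes: for a root homomorphism
`u` for `α`, the matrix `A` of `x`-linear coefficients of the entries of `u x` is non-zero — if all
coordinates of `u x` (including `det⁻¹`, a unit of `k[X]`, hence constant) had vanishing linear
term, so would the polynomial retraction `q ∘ u = X` — and comparing linear coefficients in
`t u(x) t⁻¹ = u(α(t) x)` gives `t A t⁻¹ = α(t) A`. Hence `t ↦ α(t)` lies in the `k`-span of the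
finitely many functions `t ↦ t_{ia} (t⁻¹)_{bj}` on `T`, and distinct characters `T → kˣ` are
linearly independent (Dedekind, Mathlib `linearIndependent_monoidHom`), so the roots are finite
(Mathlib `LinearIndependent.finite_of_le_span_finite`).

## References

* T. A. Springer, *Linear Algebraic Groups*, 2nd ed., Progress in Mathematics 9, Birkhäuser
  (1998), 7.1.1 (the set `P` of non-zero weights of `T` in `𝔤` "is a finite subset of `X`"),
  7.4.3 (p. 125: the roots `R(G, T) ⊆ P'`), 8.1.1 (i) (root homomorphisms `u_α`,
  `t u_α(x) t⁻¹ = u_α(α(t) x)`, `Im du_α = 𝔤_α`), 8.1.2 (the roots are the non-zero weights of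
  `T` in `𝔤`).
-/

open scoped MatrixGroups

namespace Literature.NumberTheory.Automorphic

section RootsFiniteProof

open Polynomial

variable {k : Type*} [Field k] {n : Type*} [Fintype n] [DecidableEq n]

/-- Substituting univariate polynomials `P c` for the variables of `q` and then evaluating at `x`
is evaluating `q` at the values `(P c)(x)`. [folklore] -/
theorem eval_mvPolynomialEval₂_C {σ : Type*} (P : σ → k[X]) (q : MvPolynomial σ k) (x : k) :
    (MvPolynomial.eval₂ Polynomial.C P q).eval x = MvPolynomial.eval (fun c => (P c).eval x) q := by
  induction q using MvPolynomial.induction_on with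
  | C a => simp
  | add p q hp hq => simp [hp, hq]
  | mul_X p c hp => simp [hp]

/-- If every substituted polynomial `P c` has vanishing linear coefficient, so does the result of
substituting them into any multivariate polynomial `q`. [folklore] -/
theorem coeff_one_mvPolynomialEval₂_C_eq_zero {σ : Type*} (P : σ → k[X])
    (hP : ∀ c, (P c).coeff 1 = 0) (q : MvPolynomial σ k) :
    (MvPolynomial.eval₂ Polynomial.C P q).coeff 1 = 0 := by
  induction q using MvPolynomial.induction_on with
  | C a => simp
  | add p q hp hq => simp [hp, hq]
  | mul_X p c hp =>
    rw [MvPolynomial.eval₂_mul, MvPolynomial.eval₂_X, Polynomial.mul_coeff_one, hp, hP c]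
    ring

variable {G T : Subgroup (GL n k)}

/-- The differential of a root homomorphism: if `u : 𝔾ₐ → G` is a root homomorphism for the
character `α` of `T` (over an infinite field), the matrix `A` of linear coefficients of the
entries of `u x` (the image of `d/dx` under `du`, a root vector `X_α ∈ 𝔤_α ⊆ 𝔤𝔩ₙ`) is non-zero —
this uses the polynomial retraction in `IsRootHom` — and is a weight vector of weight `α` for the
adjoint action of `T` on `𝔤𝔩ₙ`: `t A t⁻¹ = α(t) A` (Springer 8.1.1 (i): `Im du_α = 𝔤_α`).
[cite: SpringerLAG1998, 8.1.1 (i)] -/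
theorem IsRootHom.exists_weightVector [Infinite k] {hTG : T ≤ G} {α : ↥T →* kˣ}
    {u : Multiplicative k →* ↥G} (hu : IsRootHom G T hTG α u) :
    ∃ A : Matrix n n k, A ≠ 0 ∧ ∀ (t : ↥T) (i j : n),
      (((t : GL n k) : Matrix n n k) * A * ((t : GL n k) : Matrix n n k)⁻¹) i j =
        (α t : k) * A i j := by
  obtain ⟨⟨P, hP⟩, ⟨q, hq⟩, hconj⟩ := hu
  have hentry : ∀ (x : k) (a b : n),
      (((u (Multiplicative.ofAdd x) : ↥G) : GL n k) : Matrix n n k) a b =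
        (P (Sum.inl (a, b))).eval x :=
    fun x a b => by simpa using hP x (Sum.inl (a, b))
  refine ⟨Matrix.of fun a b => (P (Sum.inl (a, b))).coeff 1, ?_, ?_⟩
  · -- the linear coefficient matrix is non-zero, by the retraction `q`
    intro hA
    have hA' : ∀ a b : n, (P (Sum.inl (a, b))).coeff 1 = 0 := fun a b => by
      simpa using congrFun (congrFun hA a) b
    -- the `det⁻¹` coordinate polynomial is a unit of `k[X]`, hence constant
    have hdet : (P (Sum.inr ())).coeff 1 = 0 := by
      set M : Matrix n n k[X] := Matrix.of fun a b => P (Sum.inl (a, b)) with hM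
      have hMD : ∀ x : k, ((P (Sum.inr ())) * M.det).eval x = (1 : k[X]).eval x := by
        intro x
        have h1 : M.det.eval x =
            ((((u (Multiplicative.ofAdd x) : ↥G) : GL n k) : Matrix n n k)).det := by
          rw [← Polynomial.coe_evalRingHom, RingHom.map_det]
          congr 1
          ext a b
          simp [hM, hentry]
        have h2 : (P (Sum.inr ())).eval x =
            (((((u (Multiplicative.ofAdd x) : ↥G) : GL n k) : Matrix n n k)).det)⁻¹ := by
          simpa using (hP x (Sum.inr ())).symm
        rw [Polynomial.eval_mul, Polynomial.eval_one, h1, h2, inv_mul_cancel₀]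
        exact (Matrix.isUnits_det_units _).ne_zero
      have hunit : IsUnit (P (Sum.inr ())) :=
        IsUnit.of_mul_eq_one M.det (Polynomial.funext hMD)
      obtain ⟨r, -, hr⟩ := Polynomial.isUnit_iff.mp hunit
      simp [← hr]
    have hall : ∀ c, (P c).coeff 1 = 0 := by
      rintro (⟨a, b⟩ | ⟨⟩)
      · exact hA' a b
      · exact hdet
    -- substituting the coordinates into the retraction gives the polynomial `X`
    have hQ : MvPolynomial.eval₂ Polynomial.C P q = X := by
      apply Polynomial.funext
      intro x
      rw [eval_mvPolynomialEval₂_C, Polynomial.eval_X]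
      have hglc : glCoordFun (((u (Multiplicative.ofAdd x) : ↥G) : GL n k)) =
          fun c => (P c).eval x := funext (hP x)
      rw [← hglc]
      exact hq x
    have h01 := coeff_one_mvPolynomialEval₂_C_eq_zero P hall q
    rw [hQ, Polynomial.coeff_X_one] at h01
    exact one_ne_zero h01
  · -- comparing linear coefficients in `t u(x) t⁻¹ = u (α(t) x)`
    intro t i j
    have hpoly : (∑ b, (∑ a, C (((t : GL n k) : Matrix n n k) i a) * P (Sum.inl (a, b))) *
          C (((t : GL n k) : Matrix n n k)⁻¹ b j)) =
        (P (Sum.inl (i, j))).comp (C ((α t : kˣ) : k) * X) := by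
      apply Polynomial.funext
      intro x
      have h := congrArg (fun g : ↥G => ((g : GL n k) : Matrix n n k) i j) (hconj t x)
      simp only [Subgroup.coe_mul, Subgroup.coe_inv, Subgroup.coe_inclusion, Units.val_mul,
        Matrix.coe_units_inv, Matrix.mul_apply, hentry] at h
      simpa only [Polynomial.eval_finsetSum, Polynomial.eval_mul, Polynomial.eval_C,
        Polynomial.eval_comp, Polynomial.eval_X] using h
    have hcoeff := congrArg (fun p : k[X] => p.coeff 1) hpoly
    simp only [Polynomial.finsetSum_coeff, Polynomial.coeff_mul_C, Polynomial.coeff_C_mul,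
      Polynomial.comp_C_mul_X_coeff, pow_one] at hcoeff
    simp only [Matrix.mul_apply, Matrix.of_apply]
    rw [hcoeff, mul_comm]

/-- Over an infinite field, the set of roots of any subgroup `G ≤ GL n k` relative to any
`T ≤ GL n k` is finite. Elementary form of the standard argument (Springer 7.1.1, 7.4.3, 8.1.1–8.1.2:
the roots are non-zero weights of `T` on the Lie algebra `𝔤 ⊆ 𝔤𝔩ₙ`, and a finite-dimensional
`T`-module has finitely many weights): by `IsRootHom.exists_weightVector` each root `α`, as a
function on `T`, lies in the `k`-span of the finitely many functions `t ↦ t_{ia} (t⁻¹)_{bj}`, and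
distinct characters are linearly independent (Dedekind, `linearIndependent_monoidHom`).
[cite: SpringerLAG1998, 7.4.3 and 8.1.1] -/
theorem roots_finite_of_infinite [Infinite k] (G T : Subgroup (GL n k)) : (roots G T).Finite := by
  -- the spanning family of matrix-coefficient functions on `T`
  let F : n × n × n × n → (↥T → k) := fun c t =>
    ((t : GL n k) : Matrix n n k) c.1 c.2.1 * ((t : GL n k) : Matrix n n k)⁻¹ c.2.2.1 c.2.2.2
  -- every root, as a function on `T`, lies in the span of `F`
  have hmem : ∀ α ∈ roots G T,
      (fun t => (((α : ↥(characterLattice T)) : ↥T →* kˣ) t : k)) ∈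
        Submodule.span k (Set.range F) := by
    rintro α ⟨-, hTG, u, hu⟩
    obtain ⟨A, hA0, hA⟩ := hu.exists_weightVector
    obtain ⟨i, j, hij⟩ : ∃ i j, A i j ≠ 0 := by
      by_contra h
      push Not at h
      exact hA0 (Matrix.ext fun i j => by simp [h])
    have key : ∀ t : ↥T, (((α : ↥(characterLattice T)) : ↥T →* kˣ) t : k) =
        ∑ b, ∑ a, ((A i j)⁻¹ * A a b) * F ⟨i, a, b, j⟩ t := by
      intro t
      have h := hA t i j
      simp only [Matrix.mul_apply] at h
      calc (((α : ↥(characterLattice T)) : ↥T →* kˣ) t : k)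
          = (A i j)⁻¹ * ((((α : ↥(characterLattice T)) : ↥T →* kˣ) t : k) * A i j) := by
            field_simp
        _ = (A i j)⁻¹ * ∑ b, (∑ a, ((t : GL n k) : Matrix n n k) i a * A a b) *
              ((t : GL n k) : Matrix n n k)⁻¹ b j := by rw [h]
        _ = ∑ b, ∑ a, ((A i j)⁻¹ * A a b) * F ⟨i, a, b, j⟩ t := by
            rw [Finset.mul_sum]
            refine Finset.sum_congr rfl fun b _ => ?_
            rw [Finset.sum_mul, Finset.mul_sum]
            refine Finset.sum_congr rfl fun a _ => ?_
            simp only [F]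
            ring
    have hfun : (fun t => (((α : ↥(characterLattice T)) : ↥T →* kˣ) t : k)) =
        ∑ b, ∑ a, ((A i j)⁻¹ * A a b) • F ⟨i, a, b, j⟩ := by
      funext t
      simp only [Finset.sum_apply, Pi.smul_apply, smul_eq_mul]
      exact key t
    rw [hfun]
    exact Submodule.sum_mem _ fun b _ => Submodule.sum_mem _ fun a _ =>
      Submodule.smul_mem _ _ (Submodule.subset_span (Set.mem_range_self _))
  -- distinct roots are linearly independent functions on `T` (Dedekind)
  have hli : LinearIndependent k fun α : ↥(roots G T) =>
      fun t : ↥T => ((((α : ↥(characterLattice T)) : ↥T →* kˣ) t : kˣ) : k) := by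
    let ι : ↥(roots G T) → (↥T →* k) := fun α =>
      (Units.coeHom k).comp (((α : ↥(characterLattice T)) : ↥T →* kˣ))
    have hι : Function.Injective ι := by
      intro α β h
      apply Subtype.ext
      apply Subtype.ext
      ext t
      simpa [ι] using DFunLike.congr_fun h t
    exact (linearIndependent_monoidHom (↥T) k).comp ι hι
  have hfin : Finite ↥(roots G T) :=
    LinearIndependent.finite_of_le_span_finite _ hli (Set.range F) (by
      rintro _ ⟨α, rfl⟩
      exact hmem α α.2)
  exact Set.finite_coe_iff.mp hfin

/-- **Discharge of `roots_finite`** (Springer 7.4.3, 8.1.1): the set of roots of a connected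
reductive group relative to a maximal torus over an algebraically closed field is finite. This is
the special case of `roots_finite_of_infinite` (which needs neither reductivity nor maximality,
only an infinite ground field). [cite: SpringerLAG1998, 7.4.3 and 8.1.1] -/
theorem roots_finite_holds : roots_finite (G := G) (T := T) :=
  fun _ _ => roots_finite_of_infinite G T

end RootsFiniteProof

end Literature.NumberTheory.Automorphic
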